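import Literature.AlgebraicGeometry.Resolution.WeightedCentreOneClassLFIso
import HarnessLib

/-!
# Weighted centres — COROLLARY L-F in full: every light class, any positive rational weights (LF-MODEL §6.2 RESTRICTION TOWER + REDUCTION, §6.4)

Instrument for engine 1's `W(f)` TOY MODEL (cell `pub-rosobs`, LF-MODEL-eng1-g45 §6.2 COROLLARY (RESTRICTION TOWER) + REDUCTION and §6.4 COROLLARY L-F; statement
agreed with engine 1, CARVER-NOTES-eng1-g49 §§1–3), NOT a resolution theorem and NOT about the invariant of [AbramovichTemkinWlodarczyk2024].  AI-written, AI-gate-reviewed.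

THE FINAL STATEMENT (`ZKernel.eq_one_of_slotPinned`).  `k` perfect of characteristic `p`, `n!·u_n = 1 (n < p)`; a finite slot type `ι` with POSITIVE rational weights `w` (`wt σ = 1`;
any number of light weight-values `< p`, integral or not); `g ∈ k[ε]` `w`-homogeneous of weight `p(p+1)`; (P) in slot form (`SlotPinned w l g`) at every slot of weight `≤ p + 1`;
`V ⊇` the slots of weight `> p + 1`, all of weight `> p + 1`.  Then every `k[σ]`-automorphism `A` of `k[ε][σ]` that is `w`-graded of degree `1`, fixes `k` and `σ`, is `≡ id (mod σ)`,
is `= id` on `ε_V` and fixes `C g` — i.e. `A ∈ Iso(N, g) = graded w 1 ⊓ baseFixing ⊓ 𝔄_1 ⊓ fixSlots V ⊓ Stab(C g)` — and whose pure `σ^p`-coefficient vanishes at every slot of weight `p`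
(the `W`-slots) is the identity.  `W = ∅`: `Iso(N, g) = {1}` (`inf_stabilizer_eq_bot_of_forall_ne`, LEMMA F∅'s general form).

PROOF = the tower composed by recursion (induction on the number of light slots `#{j | w j < p}`): no light slot ⇒ the core, THEOREM F★ (`eq_one_of_core`); else let `l` minimise `w`,
`Z := {z | w z = w l}` the bottom light class: THEOREM A⁺ gives `A ∈ fixSlots Z` — for integral `w l = r ∈ {1,…,p−1}` by `BottomClimb.apply_CX_eq_of_slotPinned_class`, for
non-integral `w l` by gradedness alone (`BottomClimb.apply_CX_eq_of_forall_ne_natCast`: a datum on a minimal slot is a constant of weight `w l − s ≠ 0`; engine 1, CARVER-NOTES-eng1-g49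
§3 (b)) —, so the storey `restrictFace w Z V g` is defined at `A`; it is injective (THEOREM B with THEOREM 𝔉′, `restrictFace_injective`), lands in the isotropy group of the honest face
`(k[ε_{¬Z}][σ], w ∘ val, val ⁻¹' V, killCompl g)` (`restrictFace_mem_faceIso`) with the same pure `σ^p`-coefficients ((KL iii), `pureCoeff_restrictFace`), and the face is again a
(P)-menu of the setting (`slotPinned_face`, `isWeightedHomogeneous_killCompl`) with fewer light slots: induction.  One storey is isolated as `eq_one_of_face` (the REDUCTION step).

References: [AbramovichTemkinWlodarczyk2024, §5.1 (p. 1575), Lemma 5.2.10 (p. 1577), Thm. 5.3.1 (2)–(3) (p. 1578)]; [Lang2002, Ch. I §3, Ch. II §1, Ch. IV §1, Ch. V §5, Ch. XIII §4];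
[Matsumura1987, §27 (pp. 207–209)].
-/

namespace Literature.AlgebraicGeometry.Resolution.WeightedBlowup

open Polynomial OrderFiltration LevelProjection Truncation TailedLightFlow

/-! ## THEOREM A⁺ for EVERY light bottom class (integral: file `WeightedCentreTheoremAPlusClass`; non-integral: gradedness alone) -/

namespace BottomClimb

section Nonintegral

variable {k : Type*} [CommRing k] {ι : Type*} {w : ι → ℚ}

/-- **A graded `k[σ]`-automorphism `x ≡ id (mod σ)` fixes every slot `z` of minimal weight whose weight is not a natural number** (LF-MODEL-eng1-g45 (S4): "on a light slot a pure
term only at order `m = w_y ∈ ℕ`", at the bottom, where nothing is lighter; engine 1's lemma, CARVER-NOTES-eng1-g49 §3 (b)): the `σ^s`-coefficient of `x(ε_z)` (`s ≥ 1`) is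
`w`-homogeneous of weight `w z − s <` every variable weight, hence a constant, of weight `w z − s ≠ 0`, hence `0`.  So THEOREM A⁺ has content only for integral bottom weights.
Instrument for engine 1's `W(f)` toy model, NOT a resolution theorem. [cite: AbramovichTemkinWlodarczyk2024, §5.1 (p. 1575), Thm. 5.3.1 (2)–(3) (p. 1578); Lang2002, Ch. IV §1] -/
theorem apply_CX_eq_of_forall_ne_natCast (hw : ∀ i, 0 ≤ w i) {x : (MvPolynomial ι k)[X] ≃+* (MvPolynomial ι k)[X]}
    (hxg : x ∈ graded w (1 : ℚ)) (hx1 : x ∈ level (X : (MvPolynomial ι k)[X]) 1) {z : ι} (hmin : ∀ j, w z ≤ w j)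
    (hwz : ∀ r : ℕ, w z ≠ r) : x (C (MvPolynomial.X z)) = C (MvPolynomial.X z) := by
  have hTW : IsTW w (1 : ℚ) (w z) (x (C (MvPolynomial.X z))) := hxg.1.isTW_CX z
  have hwt : ∀ s : ℕ, MvPolynomial.IsWeightedHomogeneous w ((x (C (MvPolynomial.X z))).coeff s) (w z - s) := fun s => by
    have h := hTW s
    rwa [nsmul_eq_mul, mul_one] at h
  obtain ⟨t, ht⟩ := hx1.2 (C (MvPolynomial.X z))
  refine Polynomial.ext fun s => ?_
  rw [coeff_C]
  by_cases hs0 : s = 0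
  · subst hs0
    rw [if_pos rfl, ht, coeff_add, coeff_C_zero, pow_one, mul_coeff_zero, coeff_X_zero, zero_mul, add_zero]
  · rw [if_neg hs0]
    refine eq_zero_of_lt_of_ne_zero hw (hwt s) hmin ?_ ?_
    · have : (0 : ℚ) < s := by exact_mod_cast Nat.pos_of_ne_zero hs0
      linarith
    · intro h
      exact hwz s (by linarith)

end Nonintegral

section AnyBottom

open ZKernel

variable {k : Type*} [Field k] {ι : Type*} [Fintype ι] [DecidableEq ι] {w : ι → ℚ} {p : ℕ} [Fact p.Prime] [CharP k p] {u : ℕ → k}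

/-- **THEOREM A⁺ FOR EVERY LIGHT BOTTOM CLASS** (LF-MODEL-eng1-g45 §6.2, any positive rational bottom weight `0 < w l < p`): weights `≥ 0`, every slot of weight `> p + 1` in `V`,
`n!·u_n = 1 (n < p)`; if `g` is (P)-pinned at a slot `l` of minimal weight, then a graded `k[σ]`-automorphism `X₀ ≡ id (mod σ)` fixing `ε_V` and `g` fixes every slot `z` with
`w z = w l`.  Integral `w l = r` (`1 ≤ r ≤ p − 1` automatic): `apply_CX_eq_of_slotPinned_class`; non-integral: `apply_CX_eq_of_forall_ne_natCast` ((P) not even needed).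
Instrument for engine 1's `W(f)` toy model, NOT a resolution theorem. [cite: AbramovichTemkinWlodarczyk2024, §5.1 (p. 1575), Thm. 5.3.1 (2)–(3) (p. 1578); Lang2002, Ch. IV §1, Ch. XIII §4;
Matsumura1987, §27] -/
theorem apply_CX_eq_of_slotPinned_bottom (hu : ∀ n < p, (Nat.factorial n : k) * u n = 1) (hw : ∀ i, 0 ≤ w i) {V : Set ι}
    (hVw : ∀ i, w i ≤ (p : ℚ) + 1 ∨ i ∈ V) {X₀ : (MvPolynomial ι k)[X] ≃+* (MvPolynomial ι k)[X]} (hg : X₀ ∈ graded w (1 : ℚ))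
    (hb : X₀ ∈ baseFixing) (h1 : X₀ ∈ level (X : (MvPolynomial ι k)[X]) 1) (hV : X₀ ∈ fixSlots V) {g : MvPolynomial ι k}
    (hfix : X₀ (C g) = C g) {l : ι} (hmin : ∀ j, w l ≤ w j) (hl0 : 0 < w l) (hlp : w l < p) (hP : SlotPinned w l g)
    {z : ι} (hz : w z = w l) : X₀ (C (MvPolynomial.X z)) = C (MvPolynomial.X z) := by
  by_cases h : ∃ r : ℕ, w l = r
  · obtain ⟨r, hr⟩ := h
    have hr0 : (0 : ℚ) < r := by rw [← hr]; exact hl0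
    have hrq : (r : ℚ) < p := by rw [← hr]; exact hlp
    have hr1 : 1 ≤ r := by exact_mod_cast hr0
    have hrp : r ≤ p - 1 := by
      have : r < p := by exact_mod_cast hrq
      omega
    exact apply_CX_eq_of_slotPinned_class hu hw hVw hg hb h1 hV hfix hmin hr hr1 hrp hP hz
  · refine apply_CX_eq_of_forall_ne_natCast hw hg h1 (fun j => by rw [hz]; exact hmin j) fun r hr => h ⟨r, ?_⟩
    rw [← hz, hr]

/-- **THEOREM A⁺ for every light bottom class, subgroup form**: under the hypotheses of `apply_CX_eq_of_slotPinned_bottom`, `X₀ ∈ fixSlots {z | w z = w l}` (it fixes the whole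
bottom class).  Instrument for engine 1's `W(f)` toy model, NOT a resolution theorem. [cite: AbramovichTemkinWlodarczyk2024, §5.1 (p. 1575), Thm. 5.3.1 (2)–(3) (p. 1578); Lang2002, Ch. XIII §4] -/
theorem mem_fixSlots_bottom_of_slotPinned (hu : ∀ n < p, (Nat.factorial n : k) * u n = 1) (hw : ∀ i, 0 ≤ w i) {V : Set ι}
    (hVw : ∀ i, w i ≤ (p : ℚ) + 1 ∨ i ∈ V) {X₀ : (MvPolynomial ι k)[X] ≃+* (MvPolynomial ι k)[X]} (hg : X₀ ∈ graded w (1 : ℚ))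
    (hb : X₀ ∈ baseFixing) (h1 : X₀ ∈ level (X : (MvPolynomial ι k)[X]) 1) (hV : X₀ ∈ fixSlots V) {g : MvPolynomial ι k}
    (hfix : X₀ (C g) = C g) {l : ι} (hmin : ∀ j, w l ≤ w j) (hl0 : 0 < w l) (hlp : w l < p) (hP : SlotPinned w l g) :
    X₀ ∈ fixSlots {z | w z = w l} :=
  mem_fixSlots.mpr fun _ hz => apply_CX_eq_of_slotPinned_bottom hu hw hVw hg hb h1 hV hfix hmin hl0 hlp hP hz

end AnyBottom

end BottomClimb

/-! ## The REDUCTION storey and COROLLARY L-F -/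

namespace ZKernel

universe uk ui

variable {k : Type uk} [Field k] (p : ℕ) [Fact p.Prime] [CharP k p] {u : ℕ → k}

/-- **THE REDUCTION, one storey** (LF-MODEL-eng1-g45 §6.2 COROLLARY (RESTRICTION TOWER) + REDUCTION with THEOREM A⁺ and THEOREM B discharged): positive weights, `n!·u_n = 1 (n < p)`,
`l` a slot of minimal weight which is light (`w l < p`), `Z = {z | w z = w l}` the bottom light class, `g` (P)-pinned at every slot of weight `≤ p + 1`, `V ⊇` the slots of weight
`> p + 1`, all of weight `> p + 1`.  IF every isotropy `B ∈ graded (w ∘ val) 1 ⊓ baseFixing ⊓ 𝔄_1 ⊓ fixSlots (val ⁻¹' V) ⊓ Stab(C (killCompl g))` of the HONEST FACE `k[ε_{¬Z}][σ]` without pure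
`σ^p`-term on the face's `W`-slots is trivial, THEN every `A ∈ graded w 1 ⊓ baseFixing ⊓ 𝔄_1 ⊓ fixSlots V ⊓ Stab(C g)` without pure `σ^p`-term on the `W`-slots is trivial: `A` fixes `ε_Z`
(A⁺, `BottomClimb.apply_CX_eq_of_slotPinned_bottom`), its face image satisfies the premise ((KL iii) `pureCoeff_restrictFace`, `restrictFace_mem_faceIso`), and the storey is injective
(THEOREM B, `restrictFace_injective`, with THEOREM 𝔉′ `noTailedLightFlow`).  Instrument for engine 1's `W(f)` toy model, NOT a resolution theorem.
[cite: AbramovichTemkinWlodarczyk2024, §5.1 (p. 1575), Thm. 5.3.1 (2)–(3) (p. 1578); Lang2002, Ch. I §3, Ch. II §1, Ch. IV §1, Ch. XIII §4; Matsumura1987, §27 (pp. 207–209)] -/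
theorem eq_one_of_face (hu : ∀ n < p, (Nat.factorial n : k) * u n = 1) {ι : Type ui} [Fintype ι] [DecidableEq ι]
    {w : ι → ℚ} (hw : ∀ i, 0 < w i) {l : ι} (hmin : ∀ j, w l ≤ w j) (hlp : w l < p)
    (Z : Set ι) [DecidablePred (· ∈ Z)] (hZ : ∀ j, j ∈ Z ↔ w j = w l)
    {g : MvPolynomial ι k} (hP : ∀ l', w l' ≤ (p : ℚ) + 1 → SlotPinned w l' g)
    {V : Set ι} (hVw : ∀ i, w i ≤ (p : ℚ) + 1 ∨ i ∈ V) (hwV : ∀ i ∈ V, (p : ℚ) + 1 < w i)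
    (ih : ∀ B : (MvPolynomial {j : ι // j ∉ Z} k)[X] ≃+* (MvPolynomial {j : ι // j ∉ Z} k)[X],
      B ∈ graded (k := k) (w ∘ Subtype.val : {j : ι // j ∉ Z} → ℚ) (1 : ℚ) → B ∈ baseFixing →
      B ∈ level (X : (MvPolynomial {j : ι // j ∉ Z} k)[X]) 1 → B ∈ fixSlots (k := k) (Subtype.val ⁻¹' V : Set {j : ι // j ∉ Z}) →
      B (C (_root_.MvPolynomial.killCompl (Subtype.val_injective (p := fun j : ι => j ∉ Z)) g)) =
        C (_root_.MvPolynomial.killCompl (Subtype.val_injective (p := fun j : ι => j ∉ Z)) g) →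
      (∀ m : {j : ι // j ∉ Z}, (w ∘ Subtype.val) m = p →
        pureCoeff (B : (MvPolynomial {j : ι // j ∉ Z} k)[X] →+* (MvPolynomial {j : ι // j ∉ Z} k)[X]) m p = 0) → B = 1)
    {A : (MvPolynomial ι k)[X] ≃+* (MvPolynomial ι k)[X]} (hgr : A ∈ graded w (1 : ℚ)) (hb : A ∈ baseFixing) (h1 : A ∈ level (X : (MvPolynomial ι k)[X]) 1)
    (hV : A ∈ fixSlots V) (hfix : A (C g) = C g)
    (hW : ∀ m, w m = p → pureCoeff (A : (MvPolynomial ι k)[X] →+* (MvPolynomial ι k)[X]) m p = 0) : A = 1 := by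
  have hp : 1 < p := (Fact.out : p.Prime).one_lt
  have hw' : ∀ i, 0 ≤ w i := fun i => (hw i).le
  have hl0 : 0 < w l := hw l
  -- THEOREM A⁺: `A` fixes the bottom class `Z`
  have hZfix : A ∈ fixSlots (k := k) Z := fun z hz =>
    BottomClimb.apply_CX_eq_of_slotPinned_bottom hu hw' hVw hgr hb h1 hV hfix hmin hl0 hlp (hP l (by linarith)) ((hZ z).mp hz)
  let A' : isoFix w Z V g := ⟨A, ⟨⟨⟨⟨⟨hgr, hb⟩, h1⟩, hZfix⟩, hV⟩, MulAction.mem_stabilizer_iff.mpr hfix⟩⟩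
  -- THEOREM B (with THEOREM 𝔉′): the storey is injective
  have hN : NoTailedLightFlow p u w g := noTailedLightFlow hu hp hw hP
  have hinj := restrictFace_injective p hu hw' (fun z hz => ((hZ z).mp hz).ge) hl0 (fun z hz => by rw [(hZ z).mp hz]; exact hlp) hVw hwV hN
  -- the face image is trivial by the premise
  have hB : restrictFace w Z V g A' = 1 := by
    refine ih (restrictFace w Z V g A') (restrictFace_mem_graded hw' A') (restrictFace_mem_baseFixing A') (restrictFace_mem_level_one A')
      (restrictFace_mem_fixSlots A') (restrictFace_C_face A') (fun m hm => ?_)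
    rw [← RingEquiv.toRingHom_eq_coe, pureCoeff_restrictFace, RingEquiv.toRingHom_eq_coe]
    exact hW m.1 hm
  have hA' : A' = 1 := hinj (by rw [hB, map_one])
  exact congrArg Subtype.val hA'

/-- The core branch: no light slot (all weights `≥ p`) ⇒ THEOREM F★ (`eq_one_of_core`) with `V` read through `hVw` (bookkeeping for the induction).
Instrument for engine 1's `W(f)` toy model, NOT a resolution theorem. [cite: AbramovichTemkinWlodarczyk2024, Thm. 5.3.1 (2)–(3) (p. 1578); Lang2002, Ch. IV §1] -/
theorem eq_one_of_noLight (hperf : ∀ x : k, ∃ y : k, y ^ p = x) {ι : Type ui} [Fintype ι] [DecidableEq ι]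
    {w : ι → ℚ} (hcore : ∀ j, (p : ℚ) ≤ w j) {g : MvPolynomial ι k} (hg : MvPolynomial.IsWeightedHomogeneous w g ((p : ℚ) * (p + 1)))
    (hP : ∀ l, w l ≤ (p : ℚ) + 1 → SlotPinned w l g) {V : Set ι} (hVw : ∀ i, w i ≤ (p : ℚ) + 1 ∨ i ∈ V)
    {A : (MvPolynomial ι k)[X] ≃+* (MvPolynomial ι k)[X]} (hgr : A ∈ graded w (1 : ℚ)) (hb : A ∈ baseFixing) (h1 : A ∈ level (X : (MvPolynomial ι k)[X]) 1)
    (hV : A ∈ fixSlots V) (hfix : A (C g) = C g)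
    (hW : ∀ m, w m = p → pureCoeff (A : (MvPolynomial ι k)[X] →+* (MvPolynomial ι k)[X]) m p = 0) : A = 1 :=
  eq_one_of_core p hperf hcore hg hgr hb h1 hfix (fun j hj => hV j ((hVw j).resolve_left (not_le.mpr hj))) hW (fun i hi => hP i hi.le)

/-- COROLLARY L-F with a bound on the number of light slots — the induction behind `eq_one_of_slotPinned` (the RESTRICTION TOWER composed by recursion: each storey is `eq_one_of_face`
on the bottom light class of the current honest face, the base is `eq_one_of_noLight`).  Instrument for engine 1's `W(f)` toy model, NOT a resolution theorem.
[cite: AbramovichTemkinWlodarczyk2024, §5.1 (p. 1575), Thm. 5.3.1 (2)–(3) (p. 1578); Lang2002, Ch. I §3, Ch. IV §1, Ch. XIII §4; Matsumura1987, §27 (pp. 207–209)] -/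
theorem eq_one_of_card_light_le (hperf : ∀ x : k, ∃ y : k, y ^ p = x) (hu : ∀ n < p, (Nat.factorial n : k) * u n = 1) (n : ℕ) :
    ∀ {ι : Type ui} [Fintype ι] [DecidableEq ι] {w : ι → ℚ}, Fintype.card {j : ι // w j < (p : ℚ)} ≤ n → (∀ i, 0 < w i) →
      ∀ {g : MvPolynomial ι k}, MvPolynomial.IsWeightedHomogeneous w g ((p : ℚ) * (p + 1)) → (∀ l, w l ≤ (p : ℚ) + 1 → SlotPinned w l g) →
      ∀ {V : Set ι}, (∀ i, w i ≤ (p : ℚ) + 1 ∨ i ∈ V) → (∀ i ∈ V, (p : ℚ) + 1 < w i) →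
      ∀ {A : (MvPolynomial ι k)[X] ≃+* (MvPolynomial ι k)[X]}, A ∈ graded w (1 : ℚ) → A ∈ baseFixing → A ∈ level (X : (MvPolynomial ι k)[X]) 1 →
        A ∈ fixSlots V → A (C g) = C g →
        (∀ m, w m = p → pureCoeff (A : (MvPolynomial ι k)[X] →+* (MvPolynomial ι k)[X]) m p = 0) → A = 1 := by
  induction n with
  | zero =>
    intro ι _ _ w hcard hw g hg hP V hVw hwV A hgr hb h1 hV hfix hW
    have hE : IsEmpty {j : ι // w j < (p : ℚ)} := Fintype.card_eq_zero_iff.mp (Nat.le_zero.mp hcard)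
    exact eq_one_of_noLight p hperf (fun j => not_lt.mp fun h => hE.false ⟨j, h⟩) hg hP hVw hgr hb h1 hV hfix hW
  | succ n ih =>
    intro ι _ _ w hcard hw g hg hP V hVw hwV A hgr hb h1 hV hfix hW
    by_cases hcore : ∀ j, (p : ℚ) ≤ w j
    · exact eq_one_of_noLight p hperf hcore hg hP hVw hgr hb h1 hV hfix hW
    push Not at hcore
    obtain ⟨j₀, hj₀⟩ := hcore
    obtain ⟨l, -, hl⟩ := Finset.exists_min_image Finset.univ w ⟨j₀, Finset.mem_univ _⟩
    have hmin : ∀ j, w l ≤ w j := fun j => hl j (Finset.mem_univ j)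
    have hlp : w l < p := lt_of_le_of_lt (hmin j₀) hj₀
    -- the bottom light class and its honest face
    have hZ' : ∀ j ∈ ({z | w z = w l} : Set ι), ∀ l' ∉ ({z | w z = w l} : Set ι), w j < w l' := fun j hj l' hl' => by
      have hj' : w j = w l := hj
      refine lt_of_le_of_ne (by rw [hj']; exact hmin l') fun h => hl' ?_
      show w l' = w l
      rw [← h, hj']
    refine eq_one_of_face p hu hw hmin hlp {z | w z = w l} (fun j => Iff.rfl) hP hVw hwV (fun B hBg hBb hB1 hBV hBfix hBW => ?_) hgr hb h1 hV hfix hW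
    -- the face has fewer light slots: induction hypothesis
    have hcard' : Fintype.card {j : {j : ι // j ∉ ({z | w z = w l} : Set ι)} // (w ∘ Subtype.val) j < (p : ℚ)} ≤ n := by
      have hlt : Fintype.card {j : {j : ι // j ∉ ({z | w z = w l} : Set ι)} // (w ∘ Subtype.val) j < (p : ℚ)} <
          Fintype.card {j : ι // w j < (p : ℚ)} := by
        refine Fintype.card_lt_of_injective_of_notMem (fun x => (⟨x.1.1, x.2⟩ : {j : ι // w j < (p : ℚ)}))
          (fun x y h => ?_) (b := ⟨l, hlp⟩) ?_
        · have h' := congrArg Subtype.val h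
          exact Subtype.ext (Subtype.ext h')
        rintro ⟨x, hx⟩
        have hxl : x.1.1 = l := congrArg Subtype.val hx
        exact x.1.2 (show w x.1.1 = w l by rw [hxl])
      omega
    exact ih hcard' (fun i => hw i.1) (isWeightedHomogeneous_killCompl _ hg) (fun l' hl' => slotPinned_face _ hP hZ' l' hl')
      (fun i => hVw i.1) (fun i hi => hwV i.1 hi) hBg hBb hB1 hBV hBfix hBW

/-- **COROLLARY L-F** (= CONJECTURE L-F of the `W(f)` toy model, LF-MODEL-eng1-g45 §6.4; `k` PERFECT): for every (P)-menu of the setting — `char k = p`, `k` perfect, `n!·u_n = 1 (n < p)`,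
positive rational weights with ANY number of light weight-values (integral or not), `g` `w`-homogeneous of weight `p(p+1)`, (P) at every slot of weight `≤ p + 1`, `V ⊇` the slots of weight
`> p + 1`, all of weight `> p + 1` — every `A ∈ Iso(N, g) = graded w 1 ⊓ baseFixing ⊓ 𝔄_1 ⊓ fixSlots V ⊓ Stab(C g)` WITHOUT pure `σ^p`-term on the slots of weight `p` is the identity;
contrapositive: every non-trivial graded `k[σ]`-isotropy `≡ id (mod σ)` fixing `ε_V` has a pure `σ^p` `W`-term.  Proof: `eq_one_of_card_light_le`.  Instrument for engine 1's `W(f)` toy model,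
NOT a resolution theorem, NOT about the invariant of [AbramovichTemkinWlodarczyk2024]. [cite: AbramovichTemkinWlodarczyk2024, §5.1 (p. 1575), Thm. 5.3.1 (2)–(3) (p. 1578); Lang2002, Ch. I §3,
Ch. IV §1, Ch. V §5, Ch. XIII §4; Matsumura1987, §27 (pp. 207–209)] -/
theorem eq_one_of_slotPinned (hperf : ∀ x : k, ∃ y : k, y ^ p = x) (hu : ∀ n < p, (Nat.factorial n : k) * u n = 1)
    {ι : Type ui} [Fintype ι] [DecidableEq ι] {w : ι → ℚ} (hw : ∀ i, 0 < w i)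
    {g : MvPolynomial ι k} (hg : MvPolynomial.IsWeightedHomogeneous w g ((p : ℚ) * (p + 1))) (hP : ∀ l, w l ≤ (p : ℚ) + 1 → SlotPinned w l g)
    {V : Set ι} (hVw : ∀ i, w i ≤ (p : ℚ) + 1 ∨ i ∈ V) (hwV : ∀ i ∈ V, (p : ℚ) + 1 < w i)
    {A : (MvPolynomial ι k)[X] ≃+* (MvPolynomial ι k)[X]} (hgr : A ∈ graded w (1 : ℚ)) (hb : A ∈ baseFixing) (h1 : A ∈ level (X : (MvPolynomial ι k)[X]) 1)
    (hV : A ∈ fixSlots V) (hfix : A (C g) = C g)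
    (hW : ∀ m, w m = p → pureCoeff (A : (MvPolynomial ι k)[X] →+* (MvPolynomial ι k)[X]) m p = 0) : A = 1 :=
  eq_one_of_card_light_le p hperf hu _ le_rfl hw hg hP hVw hwV hgr hb h1 hV hfix hW

/-- **COROLLARY L-F, group form, and LEMMA F∅ in general** (LF-MODEL-eng1-g45 §6.4, second clause): under the menu hypotheses of `eq_one_of_slotPinned`, if NO slot has weight `p` (`W = ∅`)
then `Iso(N, g) = graded w 1 ⊓ baseFixing ⊓ 𝔄_1 ⊓ fixSlots V ⊓ Stab(C g) = {1}`.  Instrument for engine 1's `W(f)` toy model, NOT a resolution theorem.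
[cite: AbramovichTemkinWlodarczyk2024, §5.1 (p. 1575), Thm. 5.3.1 (2)–(3) (p. 1578); Lang2002, Ch. I §3, Ch. XIII §4] -/
theorem inf_stabilizer_eq_bot_of_forall_ne (hperf : ∀ x : k, ∃ y : k, y ^ p = x) (hu : ∀ n < p, (Nat.factorial n : k) * u n = 1)
    {ι : Type ui} [Fintype ι] [DecidableEq ι] {w : ι → ℚ} (hw : ∀ i, 0 < w i) (hWe : ∀ m, w m ≠ p)
    {g : MvPolynomial ι k} (hg : MvPolynomial.IsWeightedHomogeneous w g ((p : ℚ) * (p + 1))) (hP : ∀ l, w l ≤ (p : ℚ) + 1 → SlotPinned w l g)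
    {V : Set ι} (hVw : ∀ i, w i ≤ (p : ℚ) + 1 ∨ i ∈ V) (hwV : ∀ i ∈ V, (p : ℚ) + 1 < w i) :
    graded (k := k) w (1 : ℚ) ⊓ baseFixing ⊓ level (X : (MvPolynomial ι k)[X]) 1 ⊓ fixSlots V ⊓
        MulAction.stabilizer ((MvPolynomial ι k)[X] ≃+* (MvPolynomial ι k)[X]) (C g : (MvPolynomial ι k)[X]) = ⊥ :=
  (Subgroup.eq_bot_iff_forall _).mpr fun _ hA =>
    eq_one_of_slotPinned p hperf hu hw hg hP hVw hwV hA.1.1.1.1 hA.1.1.1.2 hA.1.1.2 hA.1.2 (MulAction.mem_stabilizer_iff.mp hA.2)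
      fun m hm => absurd hm (hWe m)

/-- **COROLLARY L-F with the canonical `V`** (`V :=` the slots of weight `> p + 1`, engine 1's reading, CARVER-NOTES-eng1-g49 §1 (D1)): the hypothesis "`A = id` on `ε_V`" becomes
`∀ j, p + 1 < w j → A (C ε_j) = C ε_j`, and no set `V` appears.  Instrument for engine 1's `W(f)` toy model, NOT a resolution theorem.
[cite: AbramovichTemkinWlodarczyk2024, §5.1 (p. 1575), Thm. 5.3.1 (2)–(3) (p. 1578); Lang2002, Ch. XIII §4; Matsumura1987, §27 (pp. 207–209)] -/
theorem eq_one_of_slotPinned_of_apply_heavy (hperf : ∀ x : k, ∃ y : k, y ^ p = x) (hu : ∀ n < p, (Nat.factorial n : k) * u n = 1)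
    {ι : Type ui} [Fintype ι] [DecidableEq ι] {w : ι → ℚ} (hw : ∀ i, 0 < w i)
    {g : MvPolynomial ι k} (hg : MvPolynomial.IsWeightedHomogeneous w g ((p : ℚ) * (p + 1))) (hP : ∀ l, w l ≤ (p : ℚ) + 1 → SlotPinned w l g)
    {A : (MvPolynomial ι k)[X] ≃+* (MvPolynomial ι k)[X]} (hgr : A ∈ graded w (1 : ℚ)) (hb : A ∈ baseFixing) (h1 : A ∈ level (X : (MvPolynomial ι k)[X]) 1)
    (hV : ∀ j, (p : ℚ) + 1 < w j → A (C (MvPolynomial.X j)) = C (MvPolynomial.X j)) (hfix : A (C g) = C g)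
    (hW : ∀ m, w m = p → pureCoeff (A : (MvPolynomial ι k)[X] →+* (MvPolynomial ι k)[X]) m p = 0) : A = 1 :=
  eq_one_of_slotPinned p hperf hu hw hg hP (V := {j | (p : ℚ) + 1 < w j}) (fun i => (le_or_gt (w i) ((p : ℚ) + 1)).imp_right id)
    (fun _ hi => hi) hgr hb h1 (mem_fixSlots.mpr fun j hj => hV j hj) hfix hW

end ZKernel

end Literature.AlgebraicGeometry.Resolution.WeightedBlowup
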